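import Summits.QuantumFields.BalabanUV.Beta.GAN24.ValueHessianLinearGauge
import Summits.QuantumFields.BalabanUV.Beta.GAN24.TransverseDictionary
import Summits.QuantumFields.BalabanUV.Beta.StepLambdaReflection

/-!
# `BalabanUV.Beta.GAN24.ValueHessianFirstMoment` — binder row G-an2-4 ∕ (CONV-C), W-slot (α-0), ROW (C) AT LEVELS `j ≥ 1`, data letter D2 of the (γ) hand:
# **THE VALUE HESSIAN KILLS THE LINEAR 1-FORMS `y ↦ y_ν·ĉ_b` — `Σ'_z E2 d Lc j (x,z)_{inl a, inl b}·z_ν = 0` for ALL `a, b, ν`, every `x`, every step `j`, every `d`, `Lc ≥ 1`**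
# (equivalently: the first moments of the translation-invariant kernel `wΦ` vanish), by E2's AXIS-REFLECTION INVARIANCE (an2's `StepLambdaReflection.refK_E2`),
# its translation invariance (`BorderedHessian.E2_inl_inl_eq_wΦ`) and its blindness to constants (D1 `ValueHessianLinearGauge.tsum_E2_mul_const_eq_zero`)
# (G-an2-4 CRUX TEAM (2), seat `b2b-balaban-gan24-formalise-leaf-06` = the (γ) hand, gen 53; journal INTENT I-leaf06-g53-4)

NOT IN PRINT; OUR BOOKKEEPING ([folklore] BY NAME: `refK_E2` (reflection), `E2_inl_inl_eq_wΦ` + `TransverseDictionary.wΦ_symm` (translation, reciprocity), D1 (`summable_decay_mul_of_linGrowth`,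
`tsum_E2_mul_const_eq_zero`), `ResolventReflection.bref_apply ∕ bref_bref` (the reflected bond base point); 0 `def`, 0 cited fact, 0 `def … : Prop`, 0 sorry).
HONEST FRAMING (cell contract, verbatim): «discharging `BetaPertH` makes Bałaban's UV stability UNCONDITIONAL — a real constructive-QFT result; it is NOT the continuum
limit and NOT the Clay problem.»  HONEST DEPENDENCY (verbatim): «continuum YM on T⁴ ⇐ BetaPertH ∧ nine spine estimates (0/9 proved); BetaPertH ⇐ (D1) ∧ (D4) ∧ CAP+tail;
G-an2-4 gates asym, D1 and NE2/3/4.»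

WHY.  The staircase currents of the E-sector EE word (`ExitFaceSlotStaircase`, `ExchangeESectorStaircase`) are `E2_{j+1}`-images of the linear-growth profile `⌊·_ν∕Lc⌋·χ_β ê_β`; to
telescope their cell pairing through `X̃♮_{j+1}` by L4′ (`ExchangeE2E2ChannelValue` §2) one trades the staircase for the bounded periodic sawtooth, `Lc·⌊y_ν∕Lc⌋ = y_ν − (y_ν % Lc)`, and the
linear piece `y_ν·χ_β ê_β = d(y_ν·⌊y_β∕Lc⌋) − ⌊y_β∕Lc⌋ ê_ν` (ν ≠ β) brings in `E2(y_β·ĉ_ν)`: THIS file shows it is ZERO.  Mechanism: `M(x) := Σ'_z E2(x,z)_{ab}·z_ν` is independent of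
`x` (translation + row sums zero); under the axis reflection `α` of `refK_E2` (`E2(x,z)_{ab} = ε^α_a ε^α_b·E2(bref α a x, bref α b z)_{ab}`, `ε^α_c = −1` iff `c = α`) the moment
picks up `ε^α_a ε^α_b` if `α ≠ ν` (`(bref α b z)_ν = z_ν`) and `−ε^α_a ε^α_b` if `α = ν` (`(bref ν b z)_ν = −1 − [b = ν] − z_ν`, constants die); choosing `α = ν` when `[a = ν] = [b = ν]`
and `α ∈ {a, b} ∖ {ν}` otherwise gives `M = −M`.
* §1 `summable_E2_mul_coord`, `tsum_E2_row_eq_zero`, `moment_transl` (`M x = M x′`); §2 `moment_refl_of_ne` (`α ≠ ν`), `moment_refl_self` (`α = ν`);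
  §3 **`tsum_E2_mul_coord_eq_zero`** (column form), **`tsum_coord_mul_E2_eq_zero`** (row form, by reciprocity).
Asserts NO value of Bałaban's tables; discharges NOTHING of (C) ∕ (C)sym ∕ (Q-L) ∕ «T2Shape» ∕ «T2Drift» ∕ (hW, hWall); NEVER «G-an2-4 closed» as (CONV-C); NOT D1, NOT `BetaPertH`,
NOT continuum, NOT Clay.  2026-08-23; no existing file touched.
-/

noncomputable section

open Finset
open scoped BigOperators
open Literature.MathematicalPhysics.QuantumFieldTheory
open Literature.MathematicalPhysics.QuantumFieldTheory.Balaban1983to89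
open Literature.MathematicalPhysics.QuantumFieldTheory.Balaban1983to89.Beta
open B12Sec2to5 (l1 l1_nonneg abs_coord_le_l1)
open ExpKernelCalculus (Site MKer)
open AffineAveraging (unitVec)
open PolarizationSign (reflSign)
open KernelReflection (refK refK_apply)
open ResolventReflection (bref bref_apply bref_bref Φ Φ_r_inl Φ_s_inl reflSign_mul_self reflSign_of_ne reflSign_self)
open KernelSpecInstance (wΦ)
open OneStepResolventKernel (Fib)
open BalabanStepJetsSucc (E2 decays_E2)
open Summit.QuantumFields.BalabanUV.Beta.BorderedHessian (E2_inl_inl_eq_wΦ)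
open Summit.QuantumFields.BalabanUV.Beta.SpineRooted (refK_E2)
open Summit.QuantumFields.BalabanUV.Beta.GAN24.TransverseDictionary (wΦ_symm)
open Summit.QuantumFields.BalabanUV.Beta.GAN24.ValueHessianLinearGauge (summable_decay_mul_of_linGrowth tsum_E2_mul_const_eq_zero tsum_const_mul_E2_eq_zero)

namespace Summit.QuantumFields.BalabanUV.Beta.GAN24.ValueHessianFirstMoment

variable {d : ℕ} {Lc : ℕ} [NeZero Lc]

/-! ## §1 Summability, row sums, translation invariance of the first moment -/

/-- [folklore] A row of the value Hessian against any function of linear growth is summable. -/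
theorem summable_E2_mul_linGrowth (j : ℕ) (x : Site (d + 1)) (a b : Fin (d + 1)) {φ : Site (d + 1) → ℝ} {A B : ℝ}
    (hφ : ∀ z, |φ z| ≤ A + B * l1 z) : Summable fun z : Site (d + 1) => E2 d Lc j x z (Sum.inl a) (Sum.inl b) * φ z := by
  obtain ⟨δ, C, hδ, -, hE⟩ := decays_E2 (d := d) (Lc := Lc) j
  exact summable_decay_mul_of_linGrowth (K := fun z => E2 d Lc j x z (Sum.inl a) (Sum.inl b)) (C := C) hδ x (fun z => hE x z _ _) hφ

/-- [folklore] A row of the value Hessian against the coordinate `z ↦ z_ν` is summable. -/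
theorem summable_E2_mul_coord (j : ℕ) (x : Site (d + 1)) (a b ν : Fin (d + 1)) :
    Summable fun z : Site (d + 1) => E2 d Lc j x z (Sum.inl a) (Sum.inl b) * ((z ν : ℤ) : ℝ) :=
  summable_E2_mul_linGrowth j x a b (A := 0) (B := 1) fun z => by rw [zero_add, one_mul]; exact abs_coord_le_l1 z ν

/-- [folklore] The row sums of the value Hessian vanish, one leg pair at a time: `Σ'_z E2 d Lc j (x,z)_{inl a, inl b} = 0` (D1 `tsum_E2_mul_const_eq_zero` on the indicator of `b`). -/
theorem tsum_E2_row_eq_zero (j : ℕ) (x : Site (d + 1)) (a b : Fin (d + 1)) : ∑' z : Site (d + 1), E2 d Lc j x z (Sum.inl a) (Sum.inl b) = 0 := by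
  have h := tsum_E2_mul_const_eq_zero (Lc := Lc) j a x (fun l => if l = b then (1 : ℝ) else 0)
  simp only [mul_ite, mul_one, mul_zero, Finset.sum_ite_eq', Finset.mem_univ, if_true] at h
  exact h

/-- [folklore] … times a constant. -/
theorem tsum_E2_mul_const_eq_zero' (j : ℕ) (x : Site (d + 1)) (a b : Fin (d + 1)) (c : ℝ) :
    ∑' z : Site (d + 1), E2 d Lc j x z (Sum.inl a) (Sum.inl b) * c = 0 := by
  rw [tsum_mul_right, tsum_E2_row_eq_zero, zero_mul]

/-- [folklore] **THE FIRST MOMENT IS TRANSLATION INVARIANT**: `Σ'_z E2(x,z)_{ab}·z_ν = Σ'_z E2(x′,z)_{ab}·z_ν` (`E2(x,z) = wΦ(x − z)` and the row sums vanish). -/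
theorem moment_transl (j : ℕ) (a b ν : Fin (d + 1)) (x x' : Site (d + 1)) :
    ∑' z : Site (d + 1), E2 d Lc j x z (Sum.inl a) (Sum.inl b) * ((z ν : ℤ) : ℝ) = ∑' z : Site (d + 1), E2 d Lc j x' z (Sum.inl a) (Sum.inl b) * ((z ν : ℤ) : ℝ) := by
  -- reindex the left sum by `z = u + (x − x′)`
  have hre : ∑' z : Site (d + 1), E2 d Lc j x z (Sum.inl a) (Sum.inl b) * ((z ν : ℤ) : ℝ) =
      ∑' u : Site (d + 1), E2 d Lc j x (u + (x - x')) (Sum.inl a) (Sum.inl b) * (((u + (x - x')) ν : ℤ) : ℝ) :=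
    ((Equiv.addRight (x - x')).tsum_eq (fun z => E2 d Lc j x z (Sum.inl a) (Sum.inl b) * ((z ν : ℤ) : ℝ))).symm
  have hker : ∀ u : Site (d + 1), E2 d Lc j x (u + (x - x')) (Sum.inl a) (Sum.inl b) = E2 d Lc j x' u (Sum.inl a) (Sum.inl b) := by
    intro u
    rw [E2_inl_inl_eq_wΦ, E2_inl_inl_eq_wΦ]
    congr 1
    abel
  have hcoord : ∀ u : Site (d + 1), (((u + (x - x')) ν : ℤ) : ℝ) = ((u ν : ℤ) : ℝ) + (((x - x') ν : ℤ) : ℝ) := by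
    intro u
    simp only [Pi.add_apply, Int.cast_add]
  rw [hre]
  simp_rw [hker, hcoord, mul_add]
  have h2 : Summable fun u : Site (d + 1) => E2 d Lc j x' u (Sum.inl a) (Sum.inl b) * (((x - x') ν : ℤ) : ℝ) :=
    summable_E2_mul_linGrowth (Lc := Lc) j x' a b (φ := fun _ => (((x - x') ν : ℤ) : ℝ)) (A := |(((x - x') ν : ℤ) : ℝ)|) (B := 0)
      fun _ => by rw [zero_mul, add_zero]
  rw [(summable_E2_mul_coord j x' a b ν).tsum_add h2, tsum_E2_mul_const_eq_zero', add_zero]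

/-! ## §2 The reflection step -/

/-- [folklore] The `ν`-coordinate of the reflected bond base point in an axis `α ≠ ν` is unchanged: `(bref α b z)_ν = z_ν`. -/
theorem bref_coord_of_ne {α ν : Fin (d + 1)} (hαν : α ≠ ν) (b : Fin (d + 1)) (z : Site (d + 1)) : (bref α b z) ν = z ν := by
  rw [bref_apply, if_neg (Ne.symm hαν)]

/-- [folklore] The `ν`-coordinate of the reflected bond base point in the axis `ν` itself: `(bref ν b z)_ν = −1 − z_ν − [b = ν]` (as reals). -/
theorem bref_coord_self (ν b : Fin (d + 1)) (z : Site (d + 1)) :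
    (((bref ν b z) ν : ℤ) : ℝ) = -1 - ((z ν : ℤ) : ℝ) - (if b = ν then (1 : ℝ) else 0) := by
  rw [bref_apply, if_pos rfl]
  split_ifs <;> push_cast <;> ring

/-- [folklore] The pointwise reflection law of the value Hessian on the field block (`refK_E2` unfolded):
`E2(x,z)_{ab} = ε^α_a ε^α_b·E2(bref α a x, bref α b z)_{ab}`. -/
theorem E2_refl (j : ℕ) (α : Fin (d + 1)) (x z : Site (d + 1)) (a b : Fin (d + 1)) :
    E2 d Lc j x z (Sum.inl a) (Sum.inl b) = reflSign α a * reflSign α b * E2 d Lc j (bref α a x) (bref α b z) (Sum.inl a) (Sum.inl b) := by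
  have h := congrFun (congrFun (congrFun (congrFun (refK_E2 (d := d) (Lc := Lc) j α) x) z) (Sum.inl a)) (Sum.inl b)
  rw [refK_apply, Φ_r_inl, Φ_r_inl, Φ_s_inl, Φ_s_inl] at h
  exact h.symm

/-- [folklore] **REFLECTION IN AN AXIS `α ≠ ν` PRESERVES THE MOMENT UP TO THE SIGN `ε^α_a ε^α_b`**:
`Σ'_z E2(x,z)_{ab}·z_ν = ε^α_a ε^α_b·Σ'_z E2(bref α a x, z)_{ab}·z_ν`. -/
theorem moment_refl_of_ne (j : ℕ) {α ν : Fin (d + 1)} (hαν : α ≠ ν) (a b : Fin (d + 1)) (x : Site (d + 1)) :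
    ∑' z : Site (d + 1), E2 d Lc j x z (Sum.inl a) (Sum.inl b) * ((z ν : ℤ) : ℝ) =
      reflSign α a * reflSign α b * ∑' z : Site (d + 1), E2 d Lc j (bref α a x) z (Sum.inl a) (Sum.inl b) * ((z ν : ℤ) : ℝ) := by
  have hre := (Equiv.tsum_eq (Function.Involutive.toPerm (bref α b) (bref_bref α b))
    (fun z : Site (d + 1) => E2 d Lc j (bref α a x) z (Sum.inl a) (Sum.inl b) * ((z ν : ℤ) : ℝ))).symm
  rw [hre, ← tsum_mul_left]
  refine tsum_congr fun z => ?_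
  rw [E2_refl j α x z a b]
  simp only [Function.Involutive.coe_toPerm, bref_coord_of_ne hαν]
  ring

/-- [folklore] **REFLECTION IN THE AXIS `ν` REVERSES THE MOMENT UP TO THE SIGN**: `Σ'_z E2(x,z)_{ab}·z_ν = −ε^ν_a ε^ν_b·Σ'_z E2(bref ν a x, z)_{ab}·z_ν`
(the constant `−1 − [b = ν]` pairs to zero against the row). -/
theorem moment_refl_self (j : ℕ) (ν a b : Fin (d + 1)) (x : Site (d + 1)) :
    ∑' z : Site (d + 1), E2 d Lc j x z (Sum.inl a) (Sum.inl b) * ((z ν : ℤ) : ℝ) =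
      -(reflSign ν a * reflSign ν b) * ∑' z : Site (d + 1), E2 d Lc j (bref ν a x) z (Sum.inl a) (Sum.inl b) * ((z ν : ℤ) : ℝ) := by
  have hre := (Equiv.tsum_eq (Function.Involutive.toPerm (bref ν b) (bref_bref ν b))
    (fun z : Site (d + 1) => E2 d Lc j (bref ν a x) z (Sum.inl a) (Sum.inl b) * (((bref ν b z) ν : ℤ) : ℝ))).symm
  -- the left side, written through the reflection and reindexed
  have hL : ∑' z : Site (d + 1), E2 d Lc j x z (Sum.inl a) (Sum.inl b) * ((z ν : ℤ) : ℝ) =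
      reflSign ν a * reflSign ν b * ∑' z : Site (d + 1), E2 d Lc j (bref ν a x) z (Sum.inl a) (Sum.inl b) * (((bref ν b z) ν : ℤ) : ℝ) := by
    rw [hre, ← tsum_mul_left]
    refine tsum_congr fun z => ?_
    rw [E2_refl j ν x z a b]
    simp only [Function.Involutive.coe_toPerm, bref_bref]
    ring
  rw [hL]
  simp_rw [bref_coord_self ν b]
  have hs := summable_E2_mul_coord (Lc := Lc) j (bref ν a x) a b ν
  have hc : Summable fun z : Site (d + 1) => E2 d Lc j (bref ν a x) z (Sum.inl a) (Sum.inl b) * (-1 - (if b = ν then (1 : ℝ) else 0)) :=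
    (summable_E2_mul_linGrowth (Lc := Lc) j (bref ν a x) a b (φ := fun _ => (-1 - (if b = ν then (1 : ℝ) else 0))) (A := |(-1 - (if b = ν then (1 : ℝ) else 0))|) (B := 0)
      fun _ => by rw [zero_mul, add_zero])
  have hsplit : ∀ z : Site (d + 1), E2 d Lc j (bref ν a x) z (Sum.inl a) (Sum.inl b) * (-1 - ((z ν : ℤ) : ℝ) - (if b = ν then (1 : ℝ) else 0)) =
      E2 d Lc j (bref ν a x) z (Sum.inl a) (Sum.inl b) * (-1 - (if b = ν then (1 : ℝ) else 0)) - E2 d Lc j (bref ν a x) z (Sum.inl a) (Sum.inl b) * ((z ν : ℤ) : ℝ) := by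
    intro z; ring
  rw [tsum_congr hsplit, hc.tsum_sub hs, tsum_E2_mul_const_eq_zero', zero_sub]
  ring

/-! ## §3 The first moment vanishes -/

/-- [folklore] **THE VALUE HESSIAN KILLS THE LINEAR 1-FORM `y ↦ y_ν·ĉ_b` (column form)**: `Σ'_z E2 d Lc j (x,z)_{inl a, inl b}·z_ν = 0` for ALL `a b ν x`, every step `j`. -/
theorem tsum_E2_mul_coord_eq_zero (j : ℕ) (a b ν : Fin (d + 1)) (x : Site (d + 1)) :
    ∑' z : Site (d + 1), E2 d Lc j x z (Sum.inl a) (Sum.inl b) * ((z ν : ℤ) : ℝ) = 0 := by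
  by_cases ha : a = ν <;> by_cases hb : b = ν
  · -- both legs along `ν`: reflect in `ν`, sign `(−1)(−1) = 1`, the moment reverses
    have h := moment_refl_self (Lc := Lc) j ν a b x
    have hsa : reflSign ν a = -1 := by rw [ha]; exact reflSign_self ν
    have hsb : reflSign ν b = -1 := by rw [hb]; exact reflSign_self ν
    rw [moment_transl j a b ν (bref ν a x) x, hsa, hsb] at h
    linarith
  · -- `a = ν ≠ b`: reflect in `b`, sign `−1`, the moment is preserved
    have h := moment_refl_of_ne (Lc := Lc) j hb a b x
    have hab : a ≠ b := fun h' => hb (by rw [← h']; exact ha)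
    rw [moment_transl j a b ν (bref b a x) x, reflSign_self, reflSign_of_ne hab] at h
    linarith
  · -- `a ≠ ν = b`: reflect in `a`
    have h := moment_refl_of_ne (Lc := Lc) j ha a b x
    have hba : b ≠ a := fun h' => ha (by rw [← h']; exact hb)
    rw [moment_transl j a b ν (bref a a x) x, reflSign_self, reflSign_of_ne hba] at h
    linarith
  · -- neither leg along `ν`: reflect in `ν`, sign `1·1 = 1`, the moment reverses
    have h := moment_refl_self (Lc := Lc) j ν a b x
    rw [moment_transl j a b ν (bref ν a x) x, reflSign_of_ne ha, reflSign_of_ne hb] at h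
    linarith

/-- [folklore] Reciprocity of the value Hessian on the field block: `E2(y,x)_{ab} = E2(x,y)_{ba}` (`wΦ_symm`). -/
theorem E2_swap (j : ℕ) (x y : Site (d + 1)) (a b : Fin (d + 1)) :
    E2 d Lc j y x (Sum.inl a) (Sum.inl b) = E2 d Lc j x y (Sum.inl b) (Sum.inl a) := by
  rw [E2_inl_inl_eq_wΦ, E2_inl_inl_eq_wΦ, wΦ_symm, neg_sub]

/-- [folklore] **… row form**: `Σ'_y y_ν·E2 d Lc j (y,x)_{inl a, inl b} = 0`. -/
theorem tsum_coord_mul_E2_eq_zero (j : ℕ) (a b ν : Fin (d + 1)) (x : Site (d + 1)) :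
    ∑' y : Site (d + 1), ((y ν : ℤ) : ℝ) * E2 d Lc j y x (Sum.inl a) (Sum.inl b) = 0 := by
  have h := tsum_E2_mul_coord_eq_zero (Lc := Lc) j b a ν x
  rw [← h]
  exact tsum_congr fun y => by rw [E2_swap j x y a b, mul_comm]

end Summit.QuantumFields.BalabanUV.Beta.GAN24.ValueHessianFirstMoment

end
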